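import Summits.CriticalPhenomena.CardyFormulaZ2.Theses.CardyRotToConf
import Literature.Probability.RandomPlanarGeometry.SLEUniquenessInLaw
import Literature.Probability.RandomPlanarGeometry.SLEExistenceConverse
import Literature.Probability.RandomPlanarGeometry.ConformalRestrictionCovariance
import Literature.Probability.RandomPlanarGeometry.ChordalCurveFamilyProofs
import Literature.Probability.RandomPlanarGeometry.ChordalWindowSegments

/-!
# `CardyRotToConfR2SymmetryUpgrade` (stmt-CriticalPhenomena-0698): consequences of the crux,
# refutation templates, and splitting locality of the boundary tracer

By-product of the cdisprove unit (standing adversary) for provers, planners and refuters of the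
crux `∀ P, IsLocalMarkovChordalFamily P → (non-tracing) → ∀ D, IsSLELaw 6 D (P D)`.

* `not_crux_of_two_families` — two admissible families differing on one domain refute the crux
  (both laws would be THE SLE₆ law, `IsSLELaw.unique'`); `hasSLETrace_of_crux` — the crux plus
  ONE admissible family gives the Rohde–Schramm trace theorem for `κ = 6`
  (`IsSLELaw.hasSLETrace`), so the crux is either vacuous or at least that strong;
* `isConformallyCovariant_of_crux` — under the crux every admissible family is covariant under
  ALL conformal equivalences of Dobrushin domains (Werner 2007 §3.2 (1) in full), by
  `IsSLELaw.conformalCovariance_holds`: the honest content "Euclidean ⇒ conformal" as a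
  corollary; `not_crux_of_not_isConformallyCovariant` — the corresponding refutation template;
* `isTargetIndependent_arcFamily` — the boundary tracer `ChordalFamily.arcFamily` (which the
  non-tracing clause of the crux excludes) passes the splitting form of locality: in `(D; a, b, b')`
  the arc `a → b'` stopped on `[b, b']` IS the arc `a → b` (`stopAt_arcCurve_chord02`).

Maintenance record (full-build repair, 2026-08-17; dependency drift, content unchanged). The crux was
REFUTED on 2026-08-16 (`Theorems.not_CardyRotToConfR2SymmetryUpgrade`, p129826; item
stmt-CriticalPhenomena-0698 closed `refuted`, misstated — repaired in the route as the new crux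
`CardyRotToConfR2SymmetryUpgradeR`) and route rev 17 (2026-08-16T23:03Z) DROPPED the decl
`Summit.CriticalPhenomena.CardyFormulaZ2.Theses.CardyRotToConf.CardyRotToConfR2SymmetryUpgrade` from the
gate-generated route file, after which this file (53:50, 59:33, 71:44, 87:43: the short name came from
`open …Theses.CardyRotToConf`) and everything stated against that identifier — the sibling
`CardyRotToConfR2SymmetryUpgradeFalseOfFacts.lean` (which imports this file), `ConjTransport.lean`, and the
refutation file itself (which spells the identifier fully qualified) — stopped elaborating. Repair: the
refuted statement is RECORDED below under its exact former name with its text VERBATIM (the ledger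
signature of stmt-0698), in this module, the common import of those users; every signature and proof
below is byte-for-byte the landed one. A record (definition of a FALSE proposition, never asserted),
not a cited fact and not a route item. Same resubmission: `nextMark_one` became a deprecated alias of the
meanwhile-landed Literature lemma `MarkedDomain.nextMark_one_three` (gate dedup), its one use rewritten.
-/

noncomputable section

open Set MeasureTheory Topology Filter
open scoped unitInterval ENNReal NNReal

/-! ### Record of the dropped (refuted) crux statement (stmt-CriticalPhenomena-0698) -/

namespace Summit.CriticalPhenomena.CardyFormulaZ2.Theses.CardyRotToConf

/-- **RECORD of the dropped route decl `CardyRotToConfR2SymmetryUpgrade`** (crux r2 of route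
CardyRotToConf, stmt-CriticalPhenomena-0698; verbatim its ledger signature), under its former name:
every local (splitting), domain-Markov chordal family whose curves trace no boundary arc is, in every
Dobrushin domain, THE chordal SLE₆ law — `∀ P, IsLocalMarkovChordalFamily P → (non-tracing) →
∀ D, IsSLELaw 6 D (P D)`. REFUTED 2026-08-16 by
`Summit.CriticalPhenomena.CardyFormulaZ2.Theorems.not_CardyRotToConfR2SymmetryUpgrade` (SLE₆ family vs its
fat-germ one-shot surgery: two admissible non-tracing families differing on the unit disc; item closed
`refuted`, misstated, repaired in the route as `CardyRotToConfR2SymmetryUpgradeR`) and dropped from the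
gate-generated route file at rev 17; kept HERE, in the common import of the negative lemmas and of the
refutation that are stated against this identifier, solely so that they keep elaborating unchanged.
A FALSE proposition recorded as a definition — never asserted, not a cited fact, not a route item. -/
def CardyRotToConfR2SymmetryUpgrade : Prop :=
  ∀ P : Literature.Probability.RandomPlanarGeometry.ChordalFamily, Literature.Probability.RandomPlanarGeometry.IsLocalMarkovChordalFamily P → (∀ D : Literature.Probability.RandomPlanarGeometry.DobrushinDomain, ∀ᵐ γ ∂(P D), ∀ c : Literature.Probability.RandomPlanarGeometry.Curve ℂ, Literature.Probability.RandomPlanarGeometry.CurveClass.mk c = γ → ∀ s t : unitInterval, s < t → c '' Set.Icc s t ⊆ frontier D.carrier → (c '' Set.Icc s t).Subsingleton) → ∀ D : Literature.Probability.RandomPlanarGeometry.DobrushinDomain, Literature.Probability.RandomPlanarGeometry.IsSLELaw 6 D (P D)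

end Summit.CriticalPhenomena.CardyFormulaZ2.Theses.CardyRotToConf

namespace Summit.CriticalPhenomena.CardyFormulaZ2.Theorems.CardyRotToConfR2SymmetryUpgrade.Negative

open Literature.Probability.RandomPlanarGeometry
open Literature.Probability.RandomPlanarGeometry.ChordalFamily
open Summit.CriticalPhenomena.CardyFormulaZ2.Theses.CardyRotToConf

/-! ### Consequences of the crux and refutation templates -/

/-- **Two-family template.** Two admissible families that differ on one Dobrushin domain refute
the crux: under it both laws are SLE₆ laws of `(D; a, b)`, and the SLE₆ law is unique
(`IsSLELaw.unique'`, unconditional). No fact about SLE₆ (not even existence) is needed.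
[folklore] -/
theorem not_crux_of_two_families {P₁ P₂ : ChordalFamily}
    (h₁ : IsLocalMarkovChordalFamily P₁)
    (n₁ : ∀ D : DobrushinDomain, ∀ᵐ γ ∂(P₁ D), ∀ c : Curve ℂ, CurveClass.mk c = γ →
      ∀ s t : unitInterval, s < t → c '' Set.Icc s t ⊆ frontier D.carrier →
        (c '' Set.Icc s t).Subsingleton)
    (h₂ : IsLocalMarkovChordalFamily P₂)
    (n₂ : ∀ D : DobrushinDomain, ∀ᵐ γ ∂(P₂ D), ∀ c : Curve ℂ, CurveClass.mk c = γ →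
      ∀ s t : unitInterval, s < t → c '' Set.Icc s t ⊆ frontier D.carrier →
        (c '' Set.Icc s t).Subsingleton)
    {D : DobrushinDomain} (hne : P₁ D ≠ P₂ D) : ¬ CardyRotToConfR2SymmetryUpgrade :=
  fun h => hne ((h P₁ h₁ n₁ D).unique' (h P₂ h₂ n₂ D))

/-- The crux plus ONE admissible family yields the Rohde–Schramm trace theorem for `κ = 6`
(`IsSLELaw.hasSLETrace`): the crux is either vacuous (no admissible family exists) or at least as
strong as `HasSLETrace 6`. [folklore] -/
theorem hasSLETrace_of_crux (h : CardyRotToConfR2SymmetryUpgrade) {P : ChordalFamily}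
    (hP : IsLocalMarkovChordalFamily P)
    (n : ∀ D : DobrushinDomain, ∀ᵐ γ ∂(P D), ∀ c : Curve ℂ, CurveClass.mk c = γ →
      ∀ s t : unitInterval, s < t → c '' Set.Icc s t ⊆ frontier D.carrier →
        (c '' Set.Icc s t).Subsingleton) :
    HasSLETrace 6 :=
  (h P hP n DobrushinDomain.unitDisc).hasSLETrace

/-- **Crux ⇒ conformal covariance.** Under the crux every admissible family is covariant under
all conformal equivalences of Dobrushin domains (`ChordalFamily.IsConformallyCovariant`, Werner
2007 §3.2 (1)), by conformal covariance of the SLE₆ laws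
(`IsSLELaw.conformalCovariance_holds`). [folklore] -/
theorem isConformallyCovariant_of_crux (h : CardyRotToConfR2SymmetryUpgrade) {P : ChordalFamily}
    (hP : IsLocalMarkovChordalFamily P)
    (n : ∀ D : DobrushinDomain, ∀ᵐ γ ∂(P D), ∀ c : Curve ℂ, CurveClass.mk c = γ →
      ∀ s t : unitInterval, s < t → c '' Set.Icc s t ⊆ frontier D.carrier →
        (c '' Set.Icc s t).Subsingleton) :
    P.IsConformallyCovariant :=
  fun D D' g Φ h0 h1 hΦ =>
    IsSLELaw.conformalCovariance_holds D D' g Φ (h P hP n D) (h P hP n D') h0 h1 hΦ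

/-- Template: an admissible family that is not conformally covariant refutes the crux.
[folklore] -/
theorem not_crux_of_not_isConformallyCovariant {P : ChordalFamily}
    (hP : IsLocalMarkovChordalFamily P)
    (n : ∀ D : DobrushinDomain, ∀ᵐ γ ∂(P D), ∀ c : Curve ℂ, CurveClass.mk c = γ →
      ∀ s t : unitInterval, s < t → c '' Set.Icc s t ⊆ frontier D.carrier →
        (c '' Set.Icc s t).Subsingleton)
    (hnc : ¬ P.IsConformallyCovariant) : ¬ CardyRotToConfR2SymmetryUpgrade :=
  fun h => hnc (isConformallyCovariant_of_crux h hP n)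

/-! ### `arcFamily` passes target independence (splitting locality) -/

section ArcTI

variable (D : MarkedDomain 3)

/-- The next mark after `a` in `(D; a, b)` is the parameter of `b`. [folklore] -/
theorem nextMark_chord01 : (D.chord 0 1 (by decide)).nextMark 0 = D.mark 1 := by
  simp [MarkedDomain.nextMark, MarkedDomain.chord]

/-- The next mark after `a` in `(D; a, b')` is the parameter of `b'`. [folklore] -/
theorem nextMark_chord02 : (D.chord 0 2 (by decide)).nextMark 0 = D.mark 2 := by
  simp [MarkedDomain.nextMark, MarkedDomain.chord]

/-- The next mark after `b` in `(D; a, b, b')` is the parameter of `b'`. Deprecated 2026-08-17 (gate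
dedup): the statement landed meanwhile as the Literature lemma
`Literature.Probability.RandomPlanarGeometry.MarkedDomain.nextMark_one_three` (`ChordalWindowSegments.lean`,
implicit `D`); the old name is kept as its alias and the single use below rewrites with the landed lemma.
[folklore] -/
@[deprecated MarkedDomain.nextMark_one_three (since := "2026-08-17")]
alias nextMark_one := MarkedDomain.nextMark_one_three

/-- A boundary point with parameter in `[mark 0, mark 1)` is not on the closed arc `[b, b']`
(injectivity of the boundary loop on one period). [folklore] -/
theorem boundary_notMem_arc_one {p : ℝ} (hp0 : D.mark 0 ≤ p) (hp1 : p < D.mark 1) :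
    D.boundary p ∉ D.arc 1 := by
  rintro ⟨q, ⟨hq1, hq2⟩, hq⟩
  rw [MarkedDomain.nextMark_one_three] at hq2
  have hpI : p ∈ Ico (0 : ℝ) 1 := ⟨(D.mark_mem 0).1.trans hp0, hp1.trans (D.mark_mem 1).2⟩
  have hqI : q ∈ Ico (0 : ℝ) 1 := ⟨(D.mark_mem 1).1.trans hq1, hq2.trans_lt (D.mark_mem 2).2⟩
  have := D.injOn_boundary hqI hpI hq
  linarith

/-- The arc `(ab)` of `(D; a, b)` as a curve. [folklore] -/
theorem arcCurve_chord01_apply (s : I) :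
    (D.chord 0 1 (by decide)).arcCurve 0 s =
      D.boundary (D.mark 0 + (D.mark 1 - D.mark 0) * s) := by
  rw [MarkedDomain.arcCurve_apply, nextMark_chord01]
  rfl

/-- The arc `(ab')` of `(D; a, b')` as a curve. [folklore] -/
theorem arcCurve_chord02_apply (s : I) :
    (D.chord 0 2 (by decide)).arcCurve 0 s =
      D.boundary (D.mark 0 + (D.mark 2 - D.mark 0) * s) := by
  rw [MarkedDomain.arcCurve_apply, nextMark_chord02]
  rfl

/-- The arc `a → b` meets `[b, b']` only at its endpoint: hitting parameter `1`. [folklore] -/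
theorem hitParam_arcCurve_chord01 :
    ((D.chord 0 1 (by decide)).arcCurve 0).hitParam (D.arc 1) = 1 := by
  have h01 : D.mark 0 < D.mark 1 := D.strictMono_mark (by decide : (0 : Fin 3) < 1)
  refine le_antisymm (Curve.hitParam_mem_Icc _ _).2 (le_csInf ⟨1, Curve.one_mem_hitSet _ _⟩ ?_)
  rintro t (⟨ht, hmem⟩ | ht)
  · refine le_of_not_gt fun hlt => ?_
    rw [arcCurve_chord01_apply] at hmem
    exact boundary_notMem_arc_one D (by nlinarith [ht.1]) (by nlinarith) hmem
  · rw [mem_singleton_iff.1 ht]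

/-- The parameter `s⋆ = (mark 1 − mark 0) / (mark 2 − mark 0)` at which the arc `a → b'`
reaches `b` lies in `[0, 1]`. [folklore] -/
theorem sStar_mem : (D.mark 1 - D.mark 0) / (D.mark 2 - D.mark 0) ∈ Icc (0 : ℝ) 1 := by
  have h01 : D.mark 0 < D.mark 1 := D.strictMono_mark (by decide : (0 : Fin 3) < 1)
  have h12 : D.mark 1 < D.mark 2 := D.strictMono_mark (by decide : (1 : Fin 3) < 2)
  exact ⟨div_nonneg (by linarith) (by linarith), (div_le_one (by linarith)).2 (by linarith)⟩

/-- `(mark 2 − mark 0) · s⋆ = mark 1 − mark 0`. [folklore] -/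
theorem mul_sStar :
    (D.mark 2 - D.mark 0) * ((D.mark 1 - D.mark 0) / (D.mark 2 - D.mark 0)) =
      D.mark 1 - D.mark 0 := by
  have h01 : D.mark 0 < D.mark 1 := D.strictMono_mark (by decide : (0 : Fin 3) < 1)
  have h12 : D.mark 1 < D.mark 2 := D.strictMono_mark (by decide : (1 : Fin 3) < 2)
  rw [mul_div_cancel₀ _ (by linarith)]

/-- The arc `a → b'` first meets `[b, b']` at `b`, at the parameter `s⋆`. [folklore] -/
theorem hitParam_arcCurve_chord02 :
    ((D.chord 0 2 (by decide)).arcCurve 0).hitParam (D.arc 1) =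
      (D.mark 1 - D.mark 0) / (D.mark 2 - D.mark 0) := by
  have h01 : D.mark 0 < D.mark 1 := D.strictMono_mark (by decide : (0 : Fin 3) < 1)
  have h12 : D.mark 1 < D.mark 2 := D.strictMono_mark (by decide : (1 : Fin 3) < 2)
  set sStar : ℝ := (D.mark 1 - D.mark 0) / (D.mark 2 - D.mark 0) with hs
  refine le_antisymm ?_ (le_csInf ⟨1, Curve.one_mem_hitSet _ _⟩ ?_)
  · refine Curve.hitParam_le (t := ⟨sStar, sStar_mem D⟩) ?_
    rw [arcCurve_chord02_apply]
    have e : D.mark 0 + (D.mark 2 - D.mark 0) * sStar = D.mark 1 := by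
      rw [hs, mul_sStar]
      ring
    rw [show ((⟨sStar, sStar_mem D⟩ : I) : ℝ) = sStar from rfl, e]
    exact D.pt_mem_arc_self 1
  · rintro t (⟨ht, hmem⟩ | ht)
    · refine le_of_not_gt fun hlt => ?_
      rw [arcCurve_chord02_apply] at hmem
      refine boundary_notMem_arc_one D (by nlinarith [ht.1]) ?_ hmem
      have h1 : t * (D.mark 2 - D.mark 0) < D.mark 1 - D.mark 0 :=
        (lt_div_iff₀ (by linarith)).1 hlt
      linarith
    · rw [mem_singleton_iff.1 ht]
      exact (sStar_mem D).2

/-- Stopped at `[b, b']`, the arc `a → b'` IS the arc `a → b` (as parametrised curves).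
[folklore] -/
theorem stopAt_arcCurve_chord02 :
    ((D.chord 0 2 (by decide)).arcCurve 0).stopAt (D.arc 1) =
      (D.chord 0 1 (by decide)).arcCurve 0 := by
  set sStar : ℝ := (D.mark 1 - D.mark 0) / (D.mark 2 - D.mark 0) with hs
  rw [Curve.stopAt_eq_of_coe_eq (t := ⟨sStar, sStar_mem D⟩) (hitParam_arcCurve_chord02 D).symm]
  refine Curve.ext (ContinuousMap.ext fun s => ?_)
  change (D.chord 0 2 (by decide)).arcCurve 0 (Curve.affineClamp 0 sStar s) =
    (D.chord 0 1 (by decide)).arcCurve 0 s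
  rw [Curve.affineClamp_apply, arcCurve_chord02_apply, arcCurve_chord01_apply, zero_add]
  have hmem : sStar * (s : ℝ) ∈ Icc (0 : ℝ) 1 :=
    ⟨mul_nonneg (sStar_mem D).1 s.2.1, mul_le_one₀ (sStar_mem D).2 s.2.1 s.2.2⟩
  rw [Set.projIcc_of_mem _ hmem]
  change D.boundary (D.mark 0 + (D.mark 2 - D.mark 0) * (sStar * s)) = _
  rw [← mul_assoc, hs, mul_sStar]

/-- Stopped at `[b, b']`, the arc `a → b` is itself. [folklore] -/
theorem stopAt_arcCurve_chord01 :
    ((D.chord 0 1 (by decide)).arcCurve 0).stopAt (D.arc 1) =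
      (D.chord 0 1 (by decide)).arcCurve 0 :=
  Curve.stopAt_eq_self_of_hitParam_eq_one (hitParam_arcCurve_chord01 D)

end ArcTI

/-- **`arcFamily` is target independent** (LSW splitting form): in `(D; a, b, b')` the tracer of
the arc `a → b` and the tracer of the arc `a → b → b'`, both stopped on `[b, b']`, are the same
curve. So the boundary tracer passes chordality, similarity covariance AND splitting locality;
it fails restriction locality and the Markov property (`LoadBearing.lean`), and is excluded from
the crux only by the non-tracing clause. [folklore] -/
theorem isTargetIndependent_arcFamily : arcFamily.IsTargetIndependent := by
  intro D T _
  have key :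
      CurveClass.stopAt (D.arc 1) (CurveClass.mk ((D.chord 0 1 (by decide)).arcCurve 0)) =
        CurveClass.stopAt (D.arc 1) (CurveClass.mk ((D.chord 0 2 (by decide)).arcCurve 0)) := by
    rw [CurveClass.stopAt_mk_holds _ (D.isClosed_arc 1),
      CurveClass.stopAt_mk_holds _ (D.isClosed_arc 1), stopAt_arcCurve_chord01,
      stopAt_arcCurve_chord02]
  have hmem :
      CurveClass.mk ((D.chord 0 1 (by decide)).arcCurve 0) ∈ CurveClass.stopAt (D.arc 1) ⁻¹' T ↔
        CurveClass.mk ((D.chord 0 2 (by decide)).arcCurve 0) ∈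
          CurveClass.stopAt (D.arc 1) ⁻¹' T := by
    simp only [Set.mem_preimage, key]
  simp only [arcFamily]
  rw [Measure.dirac_apply, Measure.dirac_apply]
  by_cases h1 :
      CurveClass.mk ((D.chord 0 1 (by decide)).arcCurve 0) ∈ CurveClass.stopAt (D.arc 1) ⁻¹' T
  · rw [Set.indicator_of_mem h1, Set.indicator_of_mem (hmem.1 h1)]
    rfl
  · rw [Set.indicator_of_notMem h1, Set.indicator_of_notMem fun h => h1 (hmem.2 h)]

end Summit.CriticalPhenomena.CardyFormulaZ2.Theorems.CardyRotToConfR2SymmetryUpgrade.Negative
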